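/-
Copyright: the b2b-balaban T⁴-continuum CRUX team, row NE7b OWNER lineage `t4-ne7b-p1` (gen 137). Project licence.
-/
import Summits.QuantumFields.BalabanUV.T4Continuum.Spine.NE7b.SupBlockEffectiveActionThird

/-!
# THE NEXT POTENTIAL OF A `C³` BLOCK INPUT IS THREE TIMES FRÉCHET DIFFERENTIABLE — the class-closure plan, item (c), second half.
# For a `C³` block potential `U` with the four block letters over `N(0,Γ)` (`Γ ⪯ γ_op·1`, regulator margin with `0 < θ`), at EVERY `ψ₀`
# the Hessian map `ψ ↦ HessW(ψ) = Z⁻¹•H(ψ) + ((Z²)⁻¹•G(ψ))⊗G(ψ)` of `W = −log Z` ((402): `Z = ∫e^{−U}`, `G = ∫e^{−U}•U′`, `H = ∫e^{−U}•(U″ − U′⊗U′)`)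
# is differentiable, with derivative the trilinear continuous map
#   `T(ψ₀) = [Z⁻¹•∫Φ + (Z⁻²G)⊗H] + [((Z⁻²G)⊗·)∘H + ((⊗)∘(Z⁻²•H + (2Z⁻³G)⊗G))ᵀG]`   (all at `ψ₀`; `∫Φ` = (418)'s derivative of `H`)
# — exactly the term the product∕quotient rules produce from `d_ψZ = −G` ((402)), `d_ψG = H` ((402)), `d_ψH = ∫Φ` ((418)); so the OUTPUT
# single-block potential `w⁺` of (415) has a third Fréchet derivative `(w⁺)‴(ζ) = T(ψ₀+ζ)`: the input format's `hU''d` for the output (row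
# NE7b, node U5c; (402)∕(418) BY NAME; [folklore])

Cell `pub-balaban`, sub-cell `t4`, spine estimate NE7b (`T4WeightBudget.RelWeightBound`; the cell's OWN estimate — NOT PRINTED in
[Bałaban 1983–89], NOT PROVED).  Crux-route work under `Spine/NE7b/` by the row OWNER (`t4-ne7b-p1` gen 137, file (419)) under FREEZE
(0)'s crux-prover clause (this gen's class-closure audit, item (c)); NOTHING of Bałaban's is named as a Lean object, valued or asserted; no
`T4Continuum/Support` leaf typed; no `def`, no notation (`T` WRITTEN OUT); zero `sorry`.  Imports (BY NAME): the OWNER's (418)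
`…SupBlockEffectiveActionThird` (`hasFDerivAt_block_tiltedHessNumerator`) and through it (402) (`hasFDerivAt_block_step`,
`hasFDerivAt_block_tiltedNumerator`, `hasFDerivAt_fderiv_block_neg_log`), (399) (`hasFDerivAt_block_neg_log`, `integrable_exp_neg_block`);
Mathlib's `hasDerivAt_inv`, `HasFDerivAt.pow`, `HasFDerivAt.smul`, `HasFDerivAt.clm_apply`.

WHAT IS PROVED ([folklore]):
* §1 `hasDerivAt_inv_sq` (`(y²)⁻¹` has derivative `−2∕y³`);
* §2 THE END **`hasFDerivAt_hessW`** (`HasFDerivAt (ψ ↦ HessW(ψ)) (T(ψ₀)) ψ₀`), **`hasFDerivAt_blockOutput_hess`** (for (415)'s output: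
  `HasFDerivAt (w⁺)″ (T(ψ₀+ζ)) ζ`); §3 toy.

HONEST (what this is NOT).  Existence and the explicit form only; the continuity of `T`, its diagonal (the line third derivative of (405)∕(406))
and a UNIFORM bound (log-concave concentration) are the next files; no contraction ((β4)), no decaying-covariance polymer expansion ((β3′));
scalar skeleton ((A3), NC-NE7b-α UNRULED); nothing of Bałaban's asserted.  BY-NAME EFFECT ON THE WALL: NONE.  NE7b NOT PRINTED ∕ NOT PROVED;
spine PROVED 0∕9; rung (B)+1 — the programme's measures remain FINITE-torus statements; NOT the mass gap, NOT Clay.  HONEST DEPENDENCY: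
continuum YM on T⁴ ⇐ BetaPertH ∧ nine spine estimates (0∕9 proved); BetaPertH ⇐ (D1) ∧ (D4) ∧ CAP+tail; G-an2-4 gates asym, D1 and NE2∕3∕4.
-/

set_option autoImplicit false
set_option maxSynthPendingDepth 3

noncomputable section

namespace Summit.QuantumFields.BalabanUV.T4Continuum.NE7b.SupBlockEffectiveActionThirdDerivative

open MeasureTheory ProbabilityTheory Finset Real Metric Filter
open scoped BigOperators Topology
open SupEffectiveActionDerivative (mul_opBound_le_of_le)
open SupBlockEffectiveActionDerivative (hasFDerivAt_block_neg_log integrable_exp_neg_block)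
open SupBlockEffectiveActionHessian (hasFDerivAt_block_step hasFDerivAt_block_tiltedNumerator hasFDerivAt_fderiv_block_neg_log)
open SupBlockEffectiveActionThird (hasFDerivAt_block_tiltedHessNumerator)

variable {ι : Type} [Fintype ι] [DecidableEq ι]

/-! ## §1. A scalar derivative -/

/-- `y ↦ (y²)⁻¹` has derivative `−2∕y³` at `y ≠ 0`. [folklore] -/
theorem hasDerivAt_inv_sq {y : ℝ} (hy : y ≠ 0) : HasDerivAt (fun y : ℝ => (y ^ 2)⁻¹) (-2 / y ^ 3) y := by
  have h := ((hasDerivAt_pow 2 y).inv (pow_ne_zero 2 hy))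
  refine h.congr_deriv ?_
  field_simp
  ring

/-! ## §2. THE END: the Hessian map is differentiable -/

section TheEnd

variable {Γ : Matrix ι ι ℝ} {γop : ℝ} {U : EuclideanSpace ℝ ι → ℝ} {U' : EuclideanSpace ℝ ι → EuclideanSpace ℝ ι →L[ℝ] ℝ}
  {U'' : EuclideanSpace ℝ ι → EuclideanSpace ℝ ι →L[ℝ] EuclideanSpace ℝ ι →L[ℝ] ℝ}
  {U₃ : EuclideanSpace ℝ ι → EuclideanSpace ℝ ι →L[ℝ] EuclideanSpace ℝ ι →L[ℝ] EuclideanSpace ℝ ι →L[ℝ] ℝ} {κ₀ κ₁ κ₂ κ₃ a τ δ θ : ℝ}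

/-- **THE END — THE HESSIAN MAP OF THE NEXT POTENTIAL OF A `C³` BLOCK INPUT IS DIFFERENTIABLE AT EVERY BACKGROUND**, with derivative
the trilinear continuous map `T(ψ₀)` of the header. [folklore] -/
theorem hasFDerivAt_hessW (hΓ : Γ.PosSemidef) (hΓop : (γop • (1 : Matrix ι ι ℝ) - Γ).PosSemidef) (Y : Finset ι)
    (hUd : ∀ φ : EuclideanSpace ℝ ι, HasFDerivAt U (U' φ) φ) (hU'd : ∀ φ : EuclideanSpace ℝ ι, HasFDerivAt U' (U'' φ) φ)
    (hU''d : ∀ φ : EuclideanSpace ℝ ι, HasFDerivAt U'' (U₃ φ) φ) (hU₃c : Continuous U₃) (hκ₀ : 0 ≤ κ₀) (hκ₁ : 0 ≤ κ₁) (ha : 0 ≤ a) (hκ₂ : 0 ≤ κ₂) (hκ₃ : 0 ≤ κ₃) (hτ : 0 <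
        τ) (hδ : 0 < δ)
    (hθ0 : 0 < θ) (hθ1 : θ < 1) (hκθ : (2 * κ₀ * (1 + τ) + 4 * δ) * γop ≤ θ) (hstab : ∀ φ : EuclideanSpace ℝ ι, -(κ₀ * ∑ x ∈ Y, φ x ^ 2) ≤ U φ)
    (hU'b : ∀ φ : EuclideanSpace ℝ ι, ‖U' φ‖ ≤ κ₁ * (a + ∑ x ∈ Y, φ x ^ 2)) (hU''b : ∀ φ : EuclideanSpace ℝ ι, ‖U'' φ‖ ≤ κ₂)
    (hU₃b : ∀ φ : EuclideanSpace ℝ ι, ‖U₃ φ‖ ≤ κ₃) (ψ₀ : EuclideanSpace ℝ ι) :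
    HasFDerivAt (fun ψ : EuclideanSpace ℝ ι => ((∫ ω : EuclideanSpace ℝ ι, exp (-U (ω + ψ)) ∂(multivariateGaussian 0 Γ))⁻¹ • (∫ ω : EuclideanSpace ℝ ι, exp (-U (ω + ψ)) •
        (U'' (ω + ψ) - (U' (ω + ψ)).smulRight (U' (ω + ψ))) ∂(multivariateGaussian 0 Γ)) + (((∫ ω : EuclideanSpace ℝ ι, exp (-U (ω + ψ)) ∂(multivariateGaussian 0 Γ)) ^ 2)⁻¹
        • ∫ ω : EuclideanSpace ℝ ι, exp (-U (ω + ψ)) • U' (ω + ψ) ∂(multivariateGaussian 0 Γ)).smulRight (∫ ω : EuclideanSpace ℝ ι, exp (-U (ω + ψ)) • U' (ω + ψ)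
        ∂(multivariateGaussian 0 Γ))))
      (((∫ ω : EuclideanSpace ℝ ι, exp (-U (ω + ψ₀)) ∂(multivariateGaussian 0 Γ))⁻¹ • (∫ ω : EuclideanSpace ℝ ι, (exp (-U (ω + ψ₀)) • (U₃ (ω + ψ₀) -
          (((ContinuousLinearMap.smulRightL ℝ (EuclideanSpace ℝ ι) (EuclideanSpace ℝ ι →L[ℝ] ℝ)) (U' (ω + ψ₀))).comp (U'' (ω + ψ₀)) + (((ContinuousLinearMap.smulRightL ℝ
          (EuclideanSpace ℝ ι) (EuclideanSpace ℝ ι →L[ℝ] ℝ))).comp (U'' (ω + ψ₀))).flip (U' (ω + ψ₀)))) + (exp (-U (ω + ψ₀)) • -U' (ω + ψ₀)).smulRight (U'' (ω + ψ₀) - (U'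
          (ω + ψ₀)).smulRight (U' (ω + ψ₀)))) ∂(multivariateGaussian 0 Γ)) + ((-((∫ ω : EuclideanSpace ℝ ι, exp (-U (ω + ψ₀)) ∂(multivariateGaussian 0 Γ)) ^ 2)⁻¹) • -(∫ ω :
          EuclideanSpace ℝ ι, exp (-U (ω + ψ₀)) • U' (ω + ψ₀) ∂(multivariateGaussian 0 Γ))).smulRight (∫ ω : EuclideanSpace ℝ ι, exp (-U (ω + ψ₀)) • (U'' (ω + ψ₀) - (U' (ω
          + ψ₀)).smulRight (U' (ω + ψ₀))) ∂(multivariateGaussian 0 Γ))) + (((ContinuousLinearMap.smulRightL ℝ (EuclideanSpace ℝ ι) (EuclideanSpace ℝ ι →L[ℝ] ℝ)) (((∫ ω :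
          EuclideanSpace ℝ ι, exp (-U (ω + ψ₀)) ∂(multivariateGaussian 0 Γ)) ^ 2)⁻¹ • (∫ ω : EuclideanSpace ℝ ι, exp (-U (ω + ψ₀)) • U' (ω + ψ₀) ∂(multivariateGaussian 0
          Γ)))).comp (∫ ω : EuclideanSpace ℝ ι, exp (-U (ω + ψ₀)) • (U'' (ω + ψ₀) - (U' (ω + ψ₀)).smulRight (U' (ω + ψ₀))) ∂(multivariateGaussian 0 Γ)) +
          (((ContinuousLinearMap.smulRightL ℝ (EuclideanSpace ℝ ι) (EuclideanSpace ℝ ι →L[ℝ] ℝ))).comp (((∫ ω : EuclideanSpace ℝ ι, exp (-U (ω + ψ₀)) ∂(multivariateGaussian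
          0 Γ)) ^ 2)⁻¹ • (∫ ω : EuclideanSpace ℝ ι, exp (-U (ω + ψ₀)) • (U'' (ω + ψ₀) - (U' (ω + ψ₀)).smulRight (U' (ω + ψ₀))) ∂(multivariateGaussian 0 Γ)) + ((-2 / (∫ ω :
          EuclideanSpace ℝ ι, exp (-U (ω + ψ₀)) ∂(multivariateGaussian 0 Γ)) ^ 3) • -(∫ ω : EuclideanSpace ℝ ι, exp (-U (ω + ψ₀)) • U' (ω + ψ₀) ∂(multivariateGaussian 0
          Γ))).smulRight (∫ ω : EuclideanSpace ℝ ι, exp (-U (ω + ψ₀)) • U' (ω + ψ₀) ∂(multivariateGaussian 0 Γ)))).flip (∫ ω : EuclideanSpace ℝ ι, exp (-U (ω + ψ₀)) • U' (ω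
          + ψ₀) ∂(multivariateGaussian 0 Γ)))) ψ₀ := by
  have hU''c : Continuous U'' := continuous_iff_continuousAt.2 fun φ => (hU''d φ).continuousAt
  have hU'c : Continuous U' := continuous_iff_continuousAt.2 fun φ => (hU'd φ).continuousAt
  have hUc : Continuous U := continuous_iff_continuousAt.2 fun φ => (hUd φ).continuousAt
  have hκθ₀ : 2 * κ₀ * (1 + τ) * γop ≤ θ := mul_opBound_le_of_le (by positivity) (by linarith) hθ0.le hκθ
  have hI := integrable_exp_neg_block hΓ hΓop Y hUc.measurable hκ₀ hτ hθ1 hκθ₀ hstab ψ₀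
  have hZ0 : 0 < (∫ ω : EuclideanSpace ℝ ι, exp (-U (ω + ψ₀)) ∂(multivariateGaussian 0 Γ)) := integral_exp_pos hI
  -- the three derivatives in the background
  have hZ := hasFDerivAt_block_step hΓ hΓop Y hUd hU'c hκ₀ hκ₁ ha hτ hδ hθ0 hθ1 hκθ hstab hU'b ψ₀
  have hG := hasFDerivAt_block_tiltedNumerator hΓ hΓop Y hUd hU'd hU''c hκ₀ hκ₁ ha hκ₂ hτ hδ hθ1 hκθ hstab hU'b hU''b ψ₀
  have hH := hasFDerivAt_block_tiltedHessNumerator hΓ hΓop Y hUd hU'd hU''d hU₃c hκ₀ hκ₁ ha hκ₂ hκ₃ hτ hδ hθ1 hκθ hstab hU'b hU''b hU₃b ψ₀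
  -- the scalar prefactors
  have hZinv := (hasDerivAt_inv hZ0.ne').comp_hasFDerivAt ψ₀ hZ
  have hZ2inv := (hasDerivAt_inv_sq hZ0.ne').comp_hasFDerivAt ψ₀ hZ
  -- term 1: `Z⁻¹ • H`
  have h1 := hZinv.smul hH
  -- term 2: `((Z²)⁻¹ • G) ⊗ G`
  have hu := hZ2inv.smul hG
  have h2 := (((ContinuousLinearMap.smulRightL ℝ (EuclideanSpace ℝ ι) (EuclideanSpace ℝ ι →L[ℝ] ℝ))).hasFDerivAt.comp ψ₀ hu).clm_apply hG
  exact h1.add h2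

end TheEnd

/-! ## §3. Toy -/

/-- Toy (§1): at `y = 1` the derivative of `(y²)⁻¹` is `−2`. -/
example : HasDerivAt (fun y : ℝ => (y ^ 2)⁻¹) (-2 / (1 : ℝ) ^ 3) 1 := hasDerivAt_inv_sq one_ne_zero

end Summit.QuantumFields.BalabanUV.T4Continuum.NE7b.SupBlockEffectiveActionThirdDerivative
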